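import Literature.MathematicalPhysics.QuantumLattice.DWaveSourceProofs
import Literature.MathematicalPhysics.QuantumLattice.GroundStateSourceBounds
import Literature.MathematicalPhysics.QuantumLattice.FinDimSpectrumProofs
import HarnessLib

/-!
# Crux `CwSsbToEvenTorusLRO` (stmt-HubbardSuperconductivity-10439, route `ChiralWindow`), line
`griffiths-block-slope` — stub `stub_sourceRemoval` (S4, source removal in the operator norm)

With `K_μ = hubbardTorusWith 2 L 1 U μ`, the sourced torus `T_h = dWaveSourceTorus L U μ h = K_μ - h O`,
`O = P + Pᴴ`, `P = pairField dWaveFormFactor L`, and the Kac block operator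
`W_R = R⁻⁴ Σ_a B_aᴴ B_a`, `B_a = Σ_{u ∈ [0,R)²} P_{a+u}`, the stub asserts, for every finite `L`, every `R`
and all real `U, μ, h, κ`,

`|E₀(T_h + κ W_R) - E₀(K_μ + κ W_R)| ≤ 12 |h| L²`.

Proof (finite-dimensional linear algebra): with `A = K_μ + κ W_R` (Hermitian) the first Hamiltonian is
`A - h O`; the two variational chords of `GroundStateSourceBounds`
(`sub_mul_re_groundStateFunctional_le` at `(0, h)` and at `(h, 0)`) sandwich `E₀(A - hO) - E₀(A)` between
`-h Re ω_{A-hO}(O)` and `-h Re ω_A(O)`, and `|Re ω_B(O)| ≤ ‖O‖` for the tracial ground state of any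
Hermitian `B` (`abs_re_groundStateFunctional_le_norm`, `L2` operator norm). Finally
`‖O‖ ≤ 2‖P‖ ≤ 2 · (2 Σ_{e ∈ {0,±e₁,±e₂}} |d(e)/√2|) · L² ≤ 12 L²` (`norm_pairField_le`; the `d`-wave sum is
`4/√2 ≤ 3` since `√2 ≥ 4/3`).

No definition is introduced; the helper lemmas are private. [folklore]
-/

noncomputable section

set_option linter.dupNamespace false

namespace Summit.HubbardSuperconductivity.HubbardSuperconductivity.Theorems.CwSsbToEvenTorusLRO

open Literature.MathematicalPhysics.QuantumLattice Matrix
open scoped Matrix ComplexOrder Matrix.Norms.L2Operator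

section Abstract

variable {n : Type*} [Fintype n] [DecidableEq n] [Nonempty n]

/-- Source removal for the ground energy, abstract form: for Hermitian `A`, `O` and real `h`,
`|E₀(A - hO) - E₀(A)| ≤ |h| ‖O‖ (operator norm) — the two variational chords with the tracial ground
states of `A` and of `A - hO`, and `|Re ω(O)| ≤ ‖O‖`. [folklore] -/
private theorem abs_groundEnergy_sub_smul_sub_le {A O : Matrix n n ℂ} (hA : A.IsHermitian)
    (hO : O.IsHermitian) (h : ℝ) :
    |(A - (h : ℂ) • O).groundEnergy - A.groundEnergy| ≤ |h| * ‖O‖ := by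
  have h1 := sub_mul_re_groundStateFunctional_le hA hO 0 h
  have h2 := sub_mul_re_groundStateFunctional_le hA hO h 0
  simp only [Complex.ofReal_zero, zero_smul, sub_zero, zero_sub, neg_mul] at h1 h2
  have hb : ∀ {B : Matrix n n ℂ}, B.IsHermitian →
      |h * (B.groundStateFunctional O).re| ≤ |h| * ‖O‖ := fun hB => by
    rw [abs_mul]
    exact mul_le_mul_of_nonneg_left (abs_re_groundStateFunctional_le_norm hB O) (abs_nonneg h)
  have c1 := hb hA
  have c2 := hb (isHermitian_sub_real_smul hA hO h)
  rw [abs_le] at c1 c2 ⊢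
  constructor <;> linarith [c1.1, c1.2, c2.1, c2.2]

end Abstract

/-- The `d`-wave numerical constant: `Σ_{e ∈ {0, ±e₁, ±e₂}} |d(e)/√2| ≤ 3` (the `e = 0` term vanishes,
`|d| ≤ 1` on the at most four unit steps, and `1/√2 ≤ 3/4` since `4/3 ≤ √2`). [folklore] -/
private theorem sum_abs_dWaveFormFactor_div_sqrt_two_le_three :
    ∑ e ∈ insert (0 : Literature.Probability.LatticeModels.Site 2) unitSteps,
      |dWaveFormFactor e / Real.sqrt 2| ≤ 3 := by
  have h0 : (0 : Literature.Probability.LatticeModels.Site 2) ∉ unitSteps := by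
    simp only [unitSteps, Finset.mem_insert, Finset.mem_singleton]
    decide
  rw [Finset.sum_insert h0, dWaveFormFactor_zero, zero_div, abs_zero, zero_add]
  have hsqrt : (4 / 3 : ℝ) ≤ Real.sqrt 2 := Real.le_sqrt_of_sq_le (by norm_num)
  have hpos : (0 : ℝ) < Real.sqrt 2 := lt_of_lt_of_le (by norm_num) hsqrt
  have hterm : ∀ e : Literature.Probability.LatticeModels.Site 2,
      |dWaveFormFactor e / Real.sqrt 2| ≤ 3 / 4 := by
    intro e
    have hd : |dWaveFormFactor e| ≤ 1 := by
      unfold dWaveFormFactor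
      split_ifs <;> norm_num
    rw [abs_div, abs_of_pos hpos, div_le_div_iff₀ hpos (by norm_num : (0 : ℝ) < 4)]
    nlinarith [hd, abs_nonneg (dWaveFormFactor e)]
  have hcard : (unitSteps.card : ℝ) ≤ 4 := by
    exact_mod_cast (Finset.card_le_four : unitSteps.card ≤ 4)
  calc ∑ e ∈ unitSteps, |dWaveFormFactor e / Real.sqrt 2|
      ≤ ∑ _e ∈ unitSteps, (3 / 4 : ℝ) := Finset.sum_le_sum fun e _ => hterm e
    _ = (unitSteps.card : ℝ) * (3 / 4) := by rw [Finset.sum_const, nsmul_eq_mul]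
    _ ≤ 4 * (3 / 4) := by gcongr
    _ = 3 := by norm_num

/-- `‖P + Pᴴ‖ ≤ 12 L²` for the `d`-wave pair field `P = pairField dWaveFormFactor L` of the `L × L` torus
(`‖Pᴴ‖ = ‖P‖ ≤ 2 · 3 · L²`). [folklore] -/
private theorem norm_pairField_add_conjTranspose_le (L : ℕ) [NeZero L] :
    ‖pairField dWaveFormFactor L + (pairField dWaveFormFactor L)ᴴ‖ ≤ 12 * (L : ℝ) ^ 2 := by
  have hP := norm_pairField_le dWaveFormFactor L
  have hS := sum_abs_dWaveFormFactor_div_sqrt_two_le_three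
  have hL : (0 : ℝ) ≤ (L : ℝ) ^ 2 := by positivity
  calc ‖pairField dWaveFormFactor L + (pairField dWaveFormFactor L)ᴴ‖
      ≤ ‖pairField dWaveFormFactor L‖ + ‖(pairField dWaveFormFactor L)ᴴ‖ := norm_add_le _ _
    _ = 2 * ‖pairField dWaveFormFactor L‖ := by rw [l2_opNorm_conjTranspose]; ring
    _ ≤ 2 * ((2 * ∑ e ∈ insert (0 : Literature.Probability.LatticeModels.Site 2) unitSteps,
          |dWaveFormFactor e / Real.sqrt 2|) * (L : ℝ) ^ 2) := by linarith
    _ ≤ 2 * ((2 * 3) * (L : ℝ) ^ 2) := by gcongr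
    _ = 12 * (L : ℝ) ^ 2 := by ring

-- adapted from `isHermitian_blockRepulsion` (private) of
-- `Theorems/ChiralWindowCwSsbToEvenTorusLROBlockSlope.lean`
/-- The Kac block operator `W_R = R⁻⁴ Σ_a B_aᴴ B_a` is Hermitian (a real multiple of a sum of
`XᴴX`'s). [folklore] -/
private theorem isHermitian_kacBlockRepulsion (L : ℕ) [NeZero L] (R : ℕ) :
    ((((((R : ℝ) ^ 4)⁻¹ : ℝ) : ℂ) • ∑ a : Literature.Probability.LatticeModels.TorusSite 2 L, (∑ u : Fin 2 → Fin R, localPair dWaveFormFactor L (a + fun i => ((u i : ℕ) : ZMod L)))ᴴ * (∑ u : Fin 2 → Fin R, localPair dWaveFormFactor L (a + fun i => ((u i : ℕ) : ZMod L))))).IsHermitian := by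
  refine IsHermitian.smul ?_ ?_
  · exact (isSelfAdjoint_sum _ fun a _ =>
      (isHermitian_conjTranspose_mul_self _).isSelfAdjoint).isHermitian
  · rw [isSelfAdjoint_iff, Complex.star_def, Complex.conj_ofReal]

/-- **Stub S4 — source removal (finite `L`, Weyl in the operator norm).**
`|E₀(T_h + κW_R) − E₀(K_μ + κW_R)| ≤ 12|h|L²` for every `L`, `R` and all real `U, μ, h, κ`: the two
Hamiltonians differ by the source `-h(P + Pᴴ)`, the ground energy is `1`-Lipschitz in the operator norm
(variational chords with the tracial ground states), and `‖P + Pᴴ‖ ≤ 2‖P‖ ≤ 12L²`.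
[cite: KomaTasaki1994, §1] -/
theorem stub_sourceRemoval :
    ∀ (L : ℕ) [NeZero L] (R : ℕ) (U μ h κ : ℝ),
      |(dWaveSourceTorus L U μ h + (κ : ℂ) • (((((R : ℝ) ^ 4)⁻¹ : ℝ) : ℂ) • ∑ a : Literature.Probability.LatticeModels.TorusSite 2 L, (∑ u : Fin 2 → Fin R, localPair dWaveFormFactor L (a + fun i => ((u i : ℕ) : ZMod L)))ᴴ * (∑ u : Fin 2 → Fin R, localPair dWaveFormFactor L (a + fun i => ((u i : ℕ) : ZMod L))))).groundEnergy -
          (hubbardTorusWith 2 L 1 U μ + (κ : ℂ) • (((((R : ℝ) ^ 4)⁻¹ : ℝ) : ℂ) • ∑ a : Literature.Probability.LatticeModels.TorusSite 2 L, (∑ u : Fin 2 → Fin R, localPair dWaveFormFactor L (a + fun i => ((u i : ℕ) : ZMod L)))ᴴ * (∑ u : Fin 2 → Fin R, localPair dWaveFormFactor L (a + fun i => ((u i : ℕ) : ZMod L))))).groundEnergy| ≤ 12 * |h| * (L : ℝ) ^ 2 := by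
  intro L _ R U μ h κ
  set W := (((((R : ℝ) ^ 4)⁻¹ : ℝ) : ℂ) • ∑ a : Literature.Probability.LatticeModels.TorusSite 2 L, (∑ u : Fin 2 → Fin R, localPair dWaveFormFactor L (a + fun i => ((u i : ℕ) : ZMod L)))ᴴ * (∑ u : Fin 2 → Fin R, localPair dWaveFormFactor L (a + fun i => ((u i : ℕ) : ZMod L))))
  have hWh : W.IsHermitian := isHermitian_kacBlockRepulsion L R
  have hA : (hubbardTorusWith 2 L 1 U μ + (κ : ℂ) • W).IsHermitian := by
    refine (isHermitian_hubbardTorusWith L 1 U μ).add (IsHermitian.smul hWh ?_)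
    rw [isSelfAdjoint_iff, Complex.star_def, Complex.conj_ofReal]
  have e : dWaveSourceTorus L U μ h + (κ : ℂ) • W =
      (hubbardTorusWith 2 L 1 U μ + (κ : ℂ) • W) -
        (h : ℂ) • (pairField dWaveFormFactor L + (pairField dWaveFormFactor L)ᴴ) := by
    rw [dWaveSourceTorus_eq]
    abel
  rw [e]
  refine (abs_groundEnergy_sub_smul_sub_le hA (isHermitian_pairField_add_conjTranspose L) h).trans ?_
  calc |h| * ‖pairField dWaveFormFactor L + (pairField dWaveFormFactor L)ᴴ‖
      ≤ |h| * (12 * (L : ℝ) ^ 2) :=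
        mul_le_mul_of_nonneg_left (norm_pairField_add_conjTranspose_le L) (abs_nonneg h)
    _ = 12 * |h| * (L : ℝ) ^ 2 := by ring

end Summit.HubbardSuperconductivity.HubbardSuperconductivity.Theorems.CwSsbToEvenTorusLRO

end
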